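import Literature.NumberTheory.PAdicHodge.AinfRamifiedOmegaPeriodNonvanishing
import Literature.NumberTheory.PAdicHodge.AinfRamifiedPTorsionTheta
import Literature.NumberTheory.PAdicHodge.EisensteinRootShortModelShape
import HarnessLib

/-!
# (N1′) over the ramified base under the ϖ-SHAPE of `[p]`: `∫_t ω ≠ 0` for every Tate-module point with `t₁ ≠ 0`, and for the
# good supersingular `𝒪_D`-models of the three K★ cells UNCONDITIONALLY (proofs only)

Topic `Literature/NumberTheory/PAdicHodge`; namespace `Literature.NumberTheory.PAdicHodge.AinfRamTop`. THEOREMS ONLY (no definition,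
no named fact, no instance, no `sorry`). Assembly of `AinfRamifiedOmegaPeriodNonvanishing` (§1 `θ_𝒪([t]) = t₀`, §2 `[p][t⁺] = [t]`,
(L1′) `∫_t ω = 0 ⇒ [t] = 0`), `AinfRamifiedPTorsionTheta` ((L2′-θ): `[p]T = 0 ⇒ θ_𝒪(T) = 0` under the ϖ-shape and the
Hasse-valuation bound) and `EisensteinRootShortModelShape` (the ϖ-shape for the cell models).

WHY. `AinfRamifiedOmegaPeriodNonvanishing.omegaPeriod_ne_zero_of_seq_one_ne_zero` assumes `[p] = p·X·R + X^{p²}·S` with unit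
`R(0), S(0)` — true for `ℤ`-models, FALSE for the `𝒪_D`-models of the K★ cells (`[X^p][p] ≡ A_p = 32a·ϱ^{r₄}` resp. `192b·ϱ^{r₆}`
is divisible by `ϱ^r`, not by `p = ϱ^e`). Here the same conclusion is derived from the TRUE ϖ-shape `[p] = ϱ·X·Q + X^{p²}·S`,
`S(0) ≡ −1 (mod ϱ)`, plus `A_p ∈ ϱ^r·𝒪_D` with `e < 2p − 1`, `e < r + (p − 1)`:

* `omegaPeriod_ne_zero_of_varpi_shape` — `∫_t ω = 0 ⟹ [t] = 0 ⟹ [p][t⁺] = 0 ⟹ θ_𝒪[t⁺] = 0` (L2′-θ) `⟹ t₁ = 0`;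
* `omegaPeriod_model_five_ne_zero` / `omegaPeriod_model_seven_ne_zero` — for the models `⟨0,0,0,a ϱ^{r₄}, b ϱ^{r₆}⟩` read in
  `CoeffDisc D`, `(e, r₄) ∈ {(3,1), (6,4)}` at `5`, `(e, r₆) = (4, 2)` at `7`, `3r₄ = e t₄`, `2r₆ = e t₆`, unit
  `64a³p^{t₄} + 432b²p^{t₆}`: **`∫_t ω ≠ 0` for every `[p]`-compatible `t` with `t₀ = 0`, `t₁ ≠ 0`** — hypothesis (N1) of the
  de Rham socket for the three potentially supersingular K★ cells, unconditionally.

BSD is not proved by any of this; K★ (`stmt-BirchSwinnertonDyer-22226`) stays open.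

## References
* [Fontaine1982FormesDifferentielles] J.-M. Fontaine, Invent. Math. 65 (1982), §5.
* [SilvermanAEC2009] J. H. Silverman, *AEC* (2009), IV.4.4, IV.7.5.
* [FarguesFontaine2018] L. Fargues, J.-M. Fontaine, Astérisque 406 (2018), §2.2.
-/

noncomputable section

open Ideal Field ValuativeRel

namespace Literature.NumberTheory.PAdicHodge

open Literature.NumberTheory.GaloisRepresentations
open Literature.NumberTheory.GaloisRepresentations.IsNonarchimedeanLocalField
open Literature.NumberTheory.GaloisRepresentations.LubinTate

namespace AinfRamTop

variable {F : Type} [Field F] [ValuativeRel F] [TopologicalSpace F] [IsNonarchimedeanLocalField F] [CharZero F]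
  {p : ℕ} [Fact p.Prime] [Fact (¬ IsUnit (p : integerC F))] [IsAdicComplete (Ideal.span {(p : integerC F)}) (integerC F)]
  {hp : valuation F p < 1} {D : EisensteinRoot F p hp}
  {hθ : Function.Surjective (WittVector.fontaineTheta (integerC F) p)}

/-- **(N1′) under the ϖ-shape**: for `W` over `𝒪_D = ℤ_p[X]/(X^e − p)` (`p` odd) with `[p] = ϱ·X·Q + X^{p²}·S`,
`S(0) + 1 ∈ (ϱ)`, `A_p(W) ∈ ϱ^r·𝒪_D`, `e < 2p − 1`, `e < r + (p − 1)`, and every `[p]`-compatible `t` in `Ŵ(𝔪_{ℂ_F})` with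
`t₀ = 0`, `t₁ ≠ 0`: **`∫_t ω ≠ 0`**. [cite: Fontaine1982FormesDifferentielles, §5] [cite: SilvermanAEC2009, IV.7.5] -/
theorem omegaPeriod_ne_zero_of_varpi_shape (W : WeierstrassCurve (EisensteinRoot.CoeffDisc D)) {e : ℕ}
    (hD : D.poly = Polynomial.X ^ e - Polynomial.C (p : ℤ_[p])) (hp2 : p ≠ 2) {Q S : PowerSeries (EisensteinRoot.CoeffDisc D)}
    (hshape : W.formalMul p = PowerSeries.C (EisensteinRoot.CoeffDisc.of D (AdjoinRoot.root D.poly)) * PowerSeries.X * Q +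
      PowerSeries.X ^ (p ^ 2) * S)
    (hS : PowerSeries.constantCoeff S + 1 ∈ Ideal.span {EisensteinRoot.CoeffDisc.of D (AdjoinRoot.root D.poly)})
    {r : ℕ} {c : EisensteinRoot.CoeffDisc D} (hA : W.hasseCoeff p = EisensteinRoot.CoeffDisc.of D (AdjoinRoot.root D.poly ^ r) * c)
    (he2 : e < 2 * p - 1) (her : e < r + (p - 1))
    {t : ℕ → (maxNilIdealC F).toIdeal} (ht0 : (t 0 : CBall F) = 0) (htp : ∀ n, mulPC W (t (n + 1)) = t n)
    (h1 : (t 1 : CBall F) ≠ 0) : omegaPeriod W hθ t ht0 htp ≠ 0 := by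
  intro h
  have hL1 : torsionLift W hθ t htp = 0 := torsionLift_eq_zero_of_omegaPeriod_eq_zero W ht0 htp h
  have hmul0 : (mulP W ⟨torsionLift W hθ (fun n => t (n + 1)) (mulPC_shift W htp), flim_mem_nilTheta _ _⟩ : AinfRamTop D) = 0 :=
    (mulP_torsionLift_shift W (hθ := hθ) htp).trans hL1
  have hθ0 := theta_torsionLift_eq_zero_of_mulP_eq_zero W hD hp2 hshape hS hA he2 her (t := fun n => t (n + 1))
    (mulPC_shift W htp) hmul0
  have hθ1 : theta D (torsionLift W hθ (fun n => t (n + 1)) (mulPC_shift W htp)) = t (0 + 1) :=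
    theta_torsionLift_eq W (hθ := hθ) (t := fun n => t (n + 1)) (mulPC_shift W htp)
  rw [hθ1, zero_add] at hθ0
  exact h1 (Subtype.ext hθ0)

/-! ## The K★ cell models -/

omit [Fact (¬ IsUnit (p : integerC F))] [IsAdicComplete (Ideal.span {(p : integerC F)}) (integerC F)] in
/-- Transport of the ϖ-shape from `D.Coeff` to the discrete synonym `CoeffDisc D`. [cite: SilvermanAEC2009, IV.7.5] -/
theorem varpi_shape_map_coeffDisc (WD : WeierstrassCurve D.Coeff) {Q S : PowerSeries D.Coeff}
    (hshape : WD.formalMul p = PowerSeries.C (AdjoinRoot.root D.poly) * PowerSeries.X * Q + PowerSeries.X ^ (p ^ 2) * S)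
    (hS : PowerSeries.constantCoeff S + 1 ∈ Ideal.span {AdjoinRoot.root D.poly}) :
    (WD.map (EisensteinRoot.CoeffDisc.of D).toRingHom).formalMul p =
        PowerSeries.C (EisensteinRoot.CoeffDisc.of D (AdjoinRoot.root D.poly)) * PowerSeries.X *
          PowerSeries.map (EisensteinRoot.CoeffDisc.of D).toRingHom Q +
        PowerSeries.X ^ (p ^ 2) * PowerSeries.map (EisensteinRoot.CoeffDisc.of D).toRingHom S ∧
      PowerSeries.constantCoeff (PowerSeries.map (EisensteinRoot.CoeffDisc.of D).toRingHom S) + 1 ∈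
        Ideal.span {EisensteinRoot.CoeffDisc.of D (AdjoinRoot.root D.poly)} := by
  refine ⟨?_, ?_⟩
  · rw [← WeierstrassCurve.map_formalMul, hshape]
    simp only [map_add, map_mul, map_pow, PowerSeries.map_C, PowerSeries.map_X, RingEquiv.toRingHom_eq_coe, RingHom.coe_coe]
  · obtain ⟨c, hc⟩ := Ideal.mem_span_singleton'.1 hS
    rw [← PowerSeries.coeff_zero_eq_constantCoeff_apply, PowerSeries.coeff_map, PowerSeries.coeff_zero_eq_constantCoeff_apply,
      RingEquiv.toRingHom_eq_coe, RingHom.coe_coe, Ideal.mem_span_singleton']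
    refine ⟨EisensteinRoot.CoeffDisc.of D c, ?_⟩
    rw [← map_mul, hc, map_add, map_one]

/-- **(N1′) on the two K★ cells at `5`**: for the models `⟨0,0,0,a ϱ^{r₄}, b ϱ^{r₆}⟩` over `𝒪_D = ℤ_5[X]/(X^e − 5)` with
`(e, r₄) ∈ {(3,1), (6,4)}`, `3r₄ = e t₄`, `2r₆ = e t₆`, `64a³5^{t₄} + 432b²5^{t₆} ∈ ℤ_5ˣ`: `∫_t ω ≠ 0` for every `[p]`-compatible
`t` with `t₀ = 0`, `t₁ ≠ 0`. [cite: Fontaine1982FormesDifferentielles, §5] [cite: SilvermanAEC2009, IV.7.5] -/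
theorem omegaPeriod_model_five_ne_zero [Fact (5 : ℕ).Prime] [Fact (¬ IsUnit ((5 : ℕ) : integerC F))]
    [IsAdicComplete (Ideal.span {((5 : ℕ) : integerC F)}) (integerC F)] {hp : valuation F (5 : ℕ) < 1}
    {D : EisensteinRoot F 5 hp} {hθ : Function.Surjective (WittVector.fontaineTheta (integerC F) 5)} {e : ℕ}
    (hD : D.poly = Polynomial.X ^ e - Polynomial.C ((5 : ℕ) : ℤ_[5])) (a b : ℤ_[5]) {r₄ r₆ t₄ t₆ : ℕ}
    (hcell : e = 3 ∧ r₄ = 1 ∨ e = 6 ∧ r₄ = 4) (h₄ : 3 * r₄ = e * t₄) (h₆ : 2 * r₆ = e * t₆)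
    (hu : IsUnit (64 * a ^ 3 * ((5 : ℕ) : ℤ_[5]) ^ t₄ + 432 * b ^ 2 * ((5 : ℕ) : ℤ_[5]) ^ t₆))
    {t : ℕ → (maxNilIdealC F).toIdeal} (ht0 : (t 0 : CBall F) = 0)
    (htp : ∀ n, mulPC (((⟨0, 0, 0, AdjoinRoot.of D.poly a * AdjoinRoot.root D.poly ^ r₄,
      AdjoinRoot.of D.poly b * AdjoinRoot.root D.poly ^ r₆⟩ : WeierstrassCurve D.Coeff).map
      (EisensteinRoot.CoeffDisc.of D).toRingHom)) (t (n + 1)) = t n)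
    (h1 : (t 1 : CBall F) ≠ 0) :
    omegaPeriod (((⟨0, 0, 0, AdjoinRoot.of D.poly a * AdjoinRoot.root D.poly ^ r₄,
      AdjoinRoot.of D.poly b * AdjoinRoot.root D.poly ^ r₆⟩ : WeierstrassCurve D.Coeff).map
      (EisensteinRoot.CoeffDisc.of D).toRingHom)) hθ t ht0 htp ≠ 0 := by
  obtain ⟨Q, S, hshape, -, hS⟩ := formalMul_prime_varpi_shape_model (D := D) hD (Or.inl rfl) a b h₄ h₆ hu
    (fun _ => by rcases hcell with ⟨-, h⟩ | ⟨-, h⟩ <;> omega) (fun h => by norm_num at h)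
  obtain ⟨hshape', hS'⟩ := varpi_shape_map_coeffDisc (p := 5) _ hshape hS
  exact omegaPeriod_ne_zero_of_varpi_shape _ hD (by norm_num) hshape' hS' (hasseCoeff_model_five a b r₄ r₆)
    (by rcases hcell with ⟨rfl, -⟩ | ⟨rfl, -⟩ <;> norm_num) (by rcases hcell with ⟨rfl, rfl⟩ | ⟨rfl, rfl⟩ <;> norm_num) ht0 htp h1

/-- **(N1′) on the K★ cell at `7`**: for the model `⟨0,0,0,a ϱ^{r₄}, b ϱ^{r₆}⟩` over `𝒪_D = ℤ_7[X]/(X^4 − 7)` with `(e, r₆) = (4, 2)`,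
`3r₄ = e t₄`, `2r₆ = e t₆`, `64a³7^{t₄} + 432b²7^{t₆} ∈ ℤ_7ˣ`: `∫_t ω ≠ 0` for every `[p]`-compatible `t` with `t₀ = 0`, `t₁ ≠ 0`.
[cite: Fontaine1982FormesDifferentielles, §5] [cite: SilvermanAEC2009, IV.7.5] -/
theorem omegaPeriod_model_seven_ne_zero [Fact (7 : ℕ).Prime] [Fact (¬ IsUnit ((7 : ℕ) : integerC F))]
    [IsAdicComplete (Ideal.span {((7 : ℕ) : integerC F)}) (integerC F)] {hp : valuation F (7 : ℕ) < 1}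
    {D : EisensteinRoot F 7 hp} {hθ : Function.Surjective (WittVector.fontaineTheta (integerC F) 7)} {e : ℕ}
    (hD : D.poly = Polynomial.X ^ e - Polynomial.C ((7 : ℕ) : ℤ_[7])) (a b : ℤ_[7]) {r₄ r₆ t₄ t₆ : ℕ}
    (hcell : e = 4 ∧ r₆ = 2) (h₄ : 3 * r₄ = e * t₄) (h₆ : 2 * r₆ = e * t₆)
    (hu : IsUnit (64 * a ^ 3 * ((7 : ℕ) : ℤ_[7]) ^ t₄ + 432 * b ^ 2 * ((7 : ℕ) : ℤ_[7]) ^ t₆))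
    {t : ℕ → (maxNilIdealC F).toIdeal} (ht0 : (t 0 : CBall F) = 0)
    (htp : ∀ n, mulPC (((⟨0, 0, 0, AdjoinRoot.of D.poly a * AdjoinRoot.root D.poly ^ r₄,
      AdjoinRoot.of D.poly b * AdjoinRoot.root D.poly ^ r₆⟩ : WeierstrassCurve D.Coeff).map
      (EisensteinRoot.CoeffDisc.of D).toRingHom)) (t (n + 1)) = t n)
    (h1 : (t 1 : CBall F) ≠ 0) :
    omegaPeriod (((⟨0, 0, 0, AdjoinRoot.of D.poly a * AdjoinRoot.root D.poly ^ r₄,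
      AdjoinRoot.of D.poly b * AdjoinRoot.root D.poly ^ r₆⟩ : WeierstrassCurve D.Coeff).map
      (EisensteinRoot.CoeffDisc.of D).toRingHom)) hθ t ht0 htp ≠ 0 := by
  obtain ⟨Q, S, hshape, -, hS⟩ := formalMul_prime_varpi_shape_model (D := D) hD (Or.inr rfl) a b h₄ h₆ hu
    (fun h => by norm_num at h) (fun _ => by rcases hcell with ⟨-, h⟩; omega)
  obtain ⟨hshape', hS'⟩ := varpi_shape_map_coeffDisc (p := 7) _ hshape hS
  exact omegaPeriod_ne_zero_of_varpi_shape _ hD (by norm_num) hshape' hS' (hasseCoeff_model_seven a b r₄ r₆)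
    (by rcases hcell with ⟨rfl, -⟩; norm_num) (by rcases hcell with ⟨rfl, rfl⟩; norm_num) ht0 htp h1

end AinfRamTop

end Literature.NumberTheory.PAdicHodge

end
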